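import Literature.Computability.Complexity.TableauCSPEvalFP
import Literature.Computability.Complexity.TableauSnapshotsProofs
import Literature.Computability.Complexity.LowDegreeExtension
import Literature.Computability.Complexity.CodeFPFinite
import HarnessLib

/-!
# The honest oracle of the scaled PCP: the low-degree extension of the tableau of a run, in polynomial time in the padded length

Literature / complexity toolkit, machine-layer brick of the probabilistically checkable proofs for
exponential-time computations (Babai–Fortnow–Lund 1991 / Babai–Fortnow–Levin–Szegedy 1991): the
PROVER's side. The honest proof of the algebraic proof system (`AlgebraicPCP.lean`) for the
arithmetized tableau (`TableauCSP.lean`) consists of the low-degree extension `Ŷ = lde H Y₀` of the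
`0/1` table `Y₀` of the intended assignment of the run (`TableauCSP.Y0`, `Tableau.intended`) and of
the honest sumcheck messages. This file computes the FIRST half — the value `Ŷ(w)` at an ARBITRARY
point `w ∈ 𝔽_pᵐ` (the prover tabulates it on all of `𝔽_pᵐ`, and the message computation of the
sequel reads it at the off-grid addresses of the constraint families) — from the run of the machine,
in time polynomial in the unary time bound (hence `2^{O(n)}` along the exponential pad):

* **`lde_Y0_intended`** (the mathematics): the extension of the intended table is the double sum
  over the blocks `(t, J)`, `t ≤ T`, `J ≤ S₁`, of the products `∏ₛ L_{vₛ}(wₛ)` for the digit point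
  `v = ptOf t J (value of block J of configuration t)` — one point per block, the one carrying the
  actual block value (`Tableau.intended_blk`), all other table entries being `0`;
* the residue semantics `cellPtN` (the `m` residues of `ptOf`), `ldeTermN` (`∏ₛ L_{vₛ}(wₛ) mod p`),
  `cellCode` (the value code of a block of the run), **`YhN`** (the double sum) and its bridge
  **`cast_YhN`**: `(YhN … w : ZMod p) = lde (nodes h) (Y0 … (intended x P T u)) w`;
* the programmes: `snapC` (the snapshot function `Tableau.snapFn` of `TableauSnapshotsProofs.lean`
  as a typed map: block `J` of configuration `t`, unary `t`, `J`, numbered by `valEquiv`),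
  `cellCodeC` (renumbered by `vcode` through a finite table), `ldeTermNC`, and **`YhNC`** —
  `(((p, 1ʰ), (1^{kt}, 1^{kJ})), ((x, u), (1^{T+1}, (1^{S₁+1}, w)))) ↦ YhN …`, polynomial time in
  this input (the step counts enter in unary: the clocked simulation is re-run for every block).

All proved; no machine is written beyond the typed combinators; no named fact.

## References

* L. Babai, L. Fortnow, C. Lund, *Non-deterministic exponential time has two-prover interactive
  protocols*, Comput. Complexity 1 (1991), §4 (the honest oracle is the multilinear / low-degree
  extension of the tableau; the provers run in exponential time) [BabaiFortnowLund1991].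
* L. Babai, L. Fortnow, L. Levin, M. Szegedy, *Checking computations in polylogarithmic time*,
  STOC 1991, §4 (the encoding is computable in time polynomial in the length of the computation)
  [BFLS1991].
* S. Arora, B. Barak, *Computational Complexity: A Modern Approach*, CUP 2009, Thm. 1.9 / §1.4.1
  (clocked simulation), §8.6 [AroraBarakCC2009].
-/

noncomputable section

open Finset Polynomial

namespace Literature.Computability.Complexity

namespace TabEval

open ModArith CodeFP Turing Tableau TableauCSP DigitPoly LowDegreeExtension AlgebraicPCP

attribute [local instance] Turing.FinTM2.kFin Turing.FinTM2.ΛFin Turing.FinTM2.σFin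
  Turing.FinTM2.Γk₀Fin

/-! ### The extension of the intended table is a sum over the blocks -/

section Math

variable {F : Type} [Field F] [DecidableEq F] (M : TM2ComputableAux Bool Bool) (L : Layout)
variable {x u : List Bool} {P T : ℕ}
  (hinj : ∀ a b : ℕ, a < L.h → b < L.h → (a : F) = b → a = b) (hh : 0 < L.h) (hval : Nat.card (Val M.tm) ≤ L.h)
  (hT : T < L.h ^ L.kt) (hS : S1 M x.length P T < L.h ^ L.kJ)

/-- Every coordinate of the point of a block is a node. [folklore] -/
theorem ptOf_mem_nodes (hval : Nat.card (Val M.tm) ≤ L.h) (t J : ℕ) (v : Val M.tm) (s : Fin (mPt L)) :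
    ptOf M L t J v s ∈ nodes (F := F) L.h := by
  have hh : 0 < L.h := lt_of_lt_of_le (Nat.pos_of_ne_zero fun h0 => by
    have := vcode_lt M v; rw [h0] at hval; omega) le_rfl
  unfold ptOf mkPt
  rcases (ptEquiv L).symm s with (i | i) | i
  · exact cast_mem_nodes (digitsOf_lt hh _ _)
  · exact cast_mem_nodes (digitsOf_lt hh _ _)
  · exact cast_mem_nodes ((vcode_lt M v).trans_le hval)

include hinj hh hval hT hS in
/-- **The low-degree extension of the intended table as a sum over the blocks**: for the intended
assignment of the run of `M` on `⟨x, u⟩`,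
`Ŷ(w) = ∑_{t ≤ T} ∑_{J ≤ S₁} ∏ₛ L_{vₛ}(wₛ)` with `v = ptOf t J (block J of configuration t)`.
[cite: BabaiFortnowLund1991, §4] -/
theorem lde_Y0_intended (w : Fin (mPt L) → F) :
    lde (nodes L.h) (Y0 M L x P T (intended (M := M) x P T u)) w =
      ∑ t ∈ range (T + 1), ∑ J ∈ range (S1 M x.length P T + 1),
        ∏ s, (Lagrange.basis (nodes (F := F) L.h) id (ptOf M L t J (absVal (cfgAt M x u t) J) s)).eval (w s) := by
  classical
  set H := nodes (F := F) L.h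
  set S : Finset (ℕ × ℕ) := range (T + 1) ×ˢ range (S1 M x.length P T + 1) with hSdef
  -- the node vector of a block
  let g : ℕ × ℕ → (Fin (mPt L) → H) := fun q s => ⟨ptOf M L q.1 q.2 (absVal (cfgAt M x u q.1) q.2) s, ptOf_mem_nodes M L hval _ _ _ s⟩
  have hg : ∀ q, (fun s => ((g q s : H) : F)) = ptOf M L q.1 q.2 (absVal (cfgAt M x u q.1) q.2) := fun q => rfl
  have hginj : Set.InjOn g S := by
    intro q hq q' hq' e
    have hq1 := mem_range.1 (mem_product.1 (mem_coe.1 hq)).1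
    have hq2 := mem_range.1 (mem_product.1 (mem_coe.1 hq)).2
    have hq1' := mem_range.1 (mem_product.1 (mem_coe.1 hq')).1
    have hq2' := mem_range.1 (mem_product.1 (mem_coe.1 hq')).2
    have e' : ptOf M L q.1 q.2 (absVal (cfgAt M x u q.1) q.2) = (ptOf M L q'.1 q'.2 (absVal (cfgAt M x u q'.1) q'.2) : Fin (mPt L) → F) := by
      rw [← hg, ← hg, e]
    obtain ⟨e1, e2, -⟩ := ptOf_inj M hinj hh hval (by omega) (by omega) (by omega) (by omega) e'
    exact Prod.ext e1 e2
  -- the table off the image vanishes, and is `1` on it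
  have hY1 : ∀ q ∈ S, Y0 M L x P T (intended (M := M) x P T u) (fun s => ((g q s : H) : F)) = 1 := by
    intro q hq
    have hq1 := mem_range.1 (mem_product.1 hq).1
    have hq2 := mem_range.1 (mem_product.1 hq).2
    rw [hg, Y0_ptOf M hinj hh hval hT hS _ (by omega) (by omega), if_pos ((intended_blk u (by omega) _).2 rfl)]
  have hY0 : ∀ c : Fin (mPt L) → H, c ∉ S.image g → Y0 M L x P T (intended (M := M) x P T u) (fun s => (c s : F)) = 0 := by
    intro c hc
    unfold Y0
    split_ifs with hq hτ
    · exfalso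
      obtain ⟨h1, h2, h3⟩ := hq.choose_spec
      have hv := (intended_blk u h2 _).1 hτ
      apply hc
      refine mem_image.2 ⟨(hq.choose.1, hq.choose.2.1), mem_product.2 ⟨mem_range.2 (by omega), mem_range.2 (by omega)⟩, ?_⟩
      funext s
      apply Subtype.ext
      have := congrFun h3 s
      rw [hv] at this
      exact this
    · rfl
    · rfl
  -- assemble
  unfold lde
  rw [← sum_subset (subset_univ (S.image g)) (fun c _ hc => by rw [ldeTerm, hY0 c hc, zero_mul]), sum_image hginj, sum_product]
  refine sum_congr rfl fun t _ => sum_congr rfl fun J hJ => ?_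
  rw [ldeTerm, hY1 (t, J) (mem_product.2 ⟨by assumption, hJ⟩), one_mul]

end Math

/-! ### Residue semantics -/

section Sem

variable (M : TM2ComputableAux Bool Bool)

/-- The residues of the point of block `(t, J)` with value code `c`: digits of `t`, digits of `J`,
`c`. [cite: BabaiFortnowLund1991, §4] -/
def cellPtN (h kt kJ t J c : ℕ) : List ℕ := constDigits h kt t ++ (constDigits h kJ J ++ [c])

/-- `∏ₛ L_{vₛ}(wₛ) mod p`. [cite: BFLS1991, §4] -/
def ldeTermN (p h : ℕ) (v w : List ℕ) : ℕ := prodM p (List.zipWith (fun a b => lagrM p h a b) v w)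

/-- **The value code of block `J` of configuration `t`** of `M` on `⟨x, u⟩`. [folklore] -/
def cellCode (x u : List Bool) (t J : ℕ) : ℕ := vcode M (absVal (cfgAt M x u t) J)

/-- **The honest oracle value** `Ŷ(w)` as the double sum over the blocks `t < Tn`, `J < Sn`.
[cite: BabaiFortnowLund1991, §4] -/
def YhN (p h kt kJ : ℕ) (x u : List Bool) (Tn Sn : ℕ) (w : List ℕ) : ℕ :=
  sumM p (((List.range Tn).map fun t => (List.range Sn).map fun J => ldeTermN p h (cellPtN h kt kJ t J (cellCode M x u t J)) w).flatten)

variable {M} {p : ℕ} [hp : Fact p.Prime] (L : Layout)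

/-- The point of a block as the cast of its residues. [folklore] -/
theorem ptOf_eq_cellPtN (t J : ℕ) (v : Val M.tm) :
    (ptOf M L t J v : Fin (mPt L) → ZMod p) = fun s : Fin (mPt L) => (((cellPtN L.h L.kt L.kJ t J (vcode M v)).getD (s : ℕ) 0 : ℕ) : ZMod p) := by
  have h := ofFn_mkPt (L := L) (fun i => ((digitsOf L.h t i : ℕ) : ZMod p)) (fun i => ((digitsOf L.h J i : ℕ) : ZMod p)) (vcode M v : ZMod p)
  have hrow : List.ofFn (fun i : Fin L.kt => ((digitsOf L.h t i : ℕ) : ZMod p)) = (constDigits L.h L.kt t).map (Nat.cast : ℕ → ZMod p) := by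
    unfold constDigits digitsOf
    rw [List.map_map, ← List.map_coe_finRange_eq_range, List.map_map, List.ofFn_eq_map]
    rfl
  have hcol : List.ofFn (fun i : Fin L.kJ => ((digitsOf L.h J i : ℕ) : ZMod p)) = (constDigits L.h L.kJ J).map (Nat.cast : ℕ → ZMod p) := by
    unfold constDigits digitsOf
    rw [List.map_map, ← List.map_coe_finRange_eq_range, List.map_map, List.ofFn_eq_map]
    rfl
  rw [hrow, hcol] at h
  unfold ptOf
  funext s
  rw [eq_getD_of_ofFn_eq h 0]
  simp only
  rw [show (constDigits L.h L.kt t).map (Nat.cast : ℕ → ZMod p) ++ ((constDigits L.h L.kJ J).map Nat.cast ++ [(vcode M v : ZMod p)]) =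
      (cellPtN L.h L.kt L.kJ t J (vcode M v)).map (Nat.cast : ℕ → ZMod p) by simp [cellPtN], List.getD_eq_getElem?_getD,
    List.getElem?_map, List.getD_eq_getElem?_getD]
  cases (cellPtN L.h L.kt L.kJ t J (vcode M v))[(s : ℕ)]? <;> simp

omit hp in
/-- Length of the residue list of a block point. [folklore] -/
@[simp] theorem length_cellPtN (h kt kJ t J c : ℕ) : (cellPtN h kt kJ t J c).length = kt + kJ + 1 := by
  simp [cellPtN, constDigits]; omega

/-- **The product of Lagrange values** on residue lists. [cite: BFLS1991, §4] -/
theorem cast_ldeTermN (hh : L.h ≤ p) {k : ℕ} (v : Fin k → ZMod p) (hv : ∀ s, v s ∈ nodes (F := ZMod p) L.h)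
    {vl : List ℕ} (hvl : v = fun s : Fin k => (((vl.getD (s : ℕ) 0 : ℕ)) : ZMod p)) (hlen : vl.length = k) (hvlt : ∀ a ∈ vl, a < L.h)
    (w : Fin k → ZMod p) :
    ((ldeTermN p L.h vl (List.ofFn fun s => (w s).val) : ℕ) : ZMod p) = ∏ s, (Lagrange.basis (nodes (F := ZMod p) L.h) id (v s)).eval (w s) := by
  subst hvl
  rw [ldeTermN, natCast_prodM, List.map_zipWith]
  have hz : List.zipWith (fun a b => ((lagrM p L.h a b : ℕ) : ZMod p)) vl (List.ofFn fun s => (w s).val) =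
      List.ofFn fun s : Fin k => (Lagrange.basis (nodes (F := ZMod p) L.h) id (((vl.getD (s : ℕ) 0 : ℕ)) : ZMod p)).eval (w s) := by
    apply List.ext_getElem
    · simp [hlen]
    · intro i h1 h2
      rw [List.length_ofFn] at h2
      rw [List.getElem_zipWith, List.getElem_ofFn, List.getElem_ofFn]
      have hi : vl[i] < L.h := hvlt _ (List.getElem_mem _)
      rw [natCast_lagrM hh hi, ZMod.natCast_zmod_val]
      simp only
      rw [List.getD_eq_getElem _ _ (by omega)]
      rfl
  rw [hz, List.prod_ofFn]

omit hp in
/-- Every residue of a block point is below `h` (for `|Val| ≤ h`, `h > 0`). [folklore] -/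
theorem cellPtN_lt (hh : 0 < L.h) (hval : Nat.card (Val M.tm) ≤ L.h) (t J : ℕ) (v : Val M.tm) :
    ∀ a ∈ cellPtN L.h L.kt L.kJ t J (vcode M v), a < L.h := by
  intro a ha
  simp only [cellPtN, constDigits, List.mem_append, List.mem_map, List.mem_range, List.mem_singleton] at ha
  rcases ha with ⟨i, -, rfl⟩ | ⟨i, -, rfl⟩ | rfl
  · exact Nat.mod_lt _ hh
  · exact Nat.mod_lt _ hh
  · exact (vcode_lt M v).trans_le hval

/-- **The honest oracle value is the low-degree extension of the intended table.** For `p` prime,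
`|Val| ≤ h ≤ p`, `T < h^{kt}`, `S₁ < h^{kJ}`:
`(YhN … (T+1) (S₁+1) w : ZMod p) = lde (nodes h) (Y0 … (intended x P T u)) w`.
[cite: BabaiFortnowLund1991, §4] -/
theorem cast_YhN (hh : L.h ≤ p) (hval : Nat.card (Val M.tm) ≤ L.h) {x u : List Bool} {P T : ℕ}
    (hT : T < L.h ^ L.kt) (hS : S1 M x.length P T < L.h ^ L.kJ) (w : Fin (mPt L) → ZMod p) :
    ((YhN M p L.h L.kt L.kJ x u (T + 1) (S1 M x.length P T + 1) (List.ofFn fun s => (w s).val) : ℕ) : ZMod p) =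
      lde (nodes (F := ZMod p) L.h) (Y0 M L x P T (intended (M := M) x P T u)) w := by
  have hpos : 0 < L.h := by have := vcode_lt M (noneVal M.tm); omega
  have hinj : ∀ a b : ℕ, a < L.h → b < L.h → (a : ZMod p) = b → a = b := fun a b ha hb e => by
    have := congrArg ZMod.val e
    rwa [ZMod.val_cast_of_lt (ha.trans_le hh), ZMod.val_cast_of_lt (hb.trans_le hh)] at this
  rw [lde_Y0_intended M L hinj hpos hval hT hS, YhN, natCast_sumM, List.map_flatten, List.map_map, List.sum_flatten,
    List.map_map, sum_map_range]
  refine sum_congr rfl fun t _ => ?_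
  rw [Function.comp_apply, Function.comp_apply, List.map_map, sum_map_range]
  refine sum_congr rfl fun J _ => ?_
  rw [Function.comp_apply]
  exact cast_ldeTermN L hh _ (fun s => ptOf_mem_nodes M L hval _ _ _ s) (ptOf_eq_cellPtN L t J _) (length_cellPtN _ _ _ _ _ _)
    (cellPtN_lt L hpos hval t J _) w

end Sem

/-! ### The programmes -/

section FP

variable (M : TM2ComputableAux Bool Bool)

/-- **The snapshot function as a typed map**: `(w, 1ᵗ, 1ᴶ, 1ᵛ) ↦ 1^{#(block J of configuration t)}`
(numbering `valEquiv`). [cite: AroraBarakCC2009, Thm. 1.9 and §1.4.1] -/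
theorem snapC : CodeFP (pairE strE (pairE unE (pairE unE unE))) unE
    (fun q => ((valEquiv M (absVal (cfgOf M q.1 q.2.1) q.2.2.1) : Fin (Nat.card (Val M.tm))) : ℕ)) := by
  refine CodeFP.of_fn (snapFn M) (snapFn_mem_FP M) fun q => ?_
  obtain ⟨w, t, J, v⟩ := q
  rw [snapFn_apply]
  have hW : qW (pairE strE (pairE unE (pairE unE unE)) (w, t, J, v)) = w := by simp [qW, pairE, strE]
  have hT : qT (pairE strE (pairE unE (pairE unE unE)) (w, t, J, v)) = t := by
    simp [qT, pairE, unE_eq_ones, ucount, ones]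
  have hJ : qJ (pairE strE (pairE unE (pairE unE unE)) (w, t, J, v)) = J := by
    simp [qJ, pairE, unE_eq_ones, ucount, ones]
  rw [hW, hT, hJ, valWord, unE_eq_ones]

/-- The renumbering `valEquiv`-number ↦ `vcode`-number (a finite table; `0` off range). [folklore] -/
def vtrans (i : ℕ) : ℕ := if h : i < Nat.card (Val M.tm) then vcode M ((valEquiv M).symm ⟨i, h⟩) else 0

/-- The renumbering is polynomial time. [folklore] -/
theorem vtransC : CodeFP unE natE (vtrans M) := by
  refine (CodeFP.ofList unE_injective natE (vtrans M) 0 (List.range (Nat.card (Val M.tm)))).congr fun i => ?_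
  by_cases hi : i < Nat.card (Val M.tm)
  · rw [if_pos (List.mem_range.2 hi)]
  · rw [if_neg (fun h => hi (List.mem_range.1 h)), vtrans, dif_neg hi]

/-- **The value code of a block of the run** off `((x, u), (1ᵗ, 1ᴶ))`. [folklore] -/
theorem cellCodeC : CodeFP (pairE (pairE strE strE) (pairE unE unE)) natE (fun q => cellCode M q.1.1 q.1.2 q.2.1 q.2.2) := by
  have hw : CodeFP (pairE (pairE strE strE) (pairE unE unE)) strE (fun q => boolPair q.1.1 q.1.2) :=
    (CodeFP.transparent (eα := pairE strE strE) (eβ := strE) (g := fun q : List Bool × List Bool => boolPair q.1 q.2)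
      fun _ => rfl).comp (CodeFP.fst _ _)
  have hs := (snapC M).comp (hw.pair ((CodeFP.snd _ _).fst'.pair ((CodeFP.snd _ _).snd'.pair (CodeFP.const _ 0))))
  refine ((vtransC M).comp hs).congr fun q => ?_
  dsimp only [Function.comp_apply]
  rw [vtrans, dif_pos (Fin.is_lt _), Fin.eta, Equiv.symm_apply_apply, cellCode, cfgAt_eq_cfgOf]

/-- **The product of Lagrange values** off `((p, 1ʰ), (v, w))`. [cite: BFLS1991, §4] -/
theorem ldeTermNC : CodeFP (pairE qhE (pairE (rawE natE) (rawE natE))) natE (fun t => ldeTermN t.1.1 t.1.2 t.2.1 t.2.2) := by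
  have hI : CodeFP (pairE qhE (pairE natE natE)) natE (fun t => lagrM t.1.1 t.1.2 t.2.1 t.2.2) := lagrMod
  exact (modProd (CodeFP.fst _ _).fst' (CodeFP.zipWith hI)).congr fun t => rfl

/-- `cellPtN` off `((1ʰ, 1^{kt}, 1^{kJ}), (t, J, c))`. [folklore] -/
theorem cellPtNC : CodeFP (pairE hkE (pairE natE (pairE natE natE))) (rawE natE)
    (fun t => cellPtN t.1.1 t.1.2.1 t.1.2.2 t.2.1 t.2.2.1 t.2.2.2) := by
  have hr : CodeFP (pairE hkE (pairE natE (pairE natE natE))) (rawE natE) (fun t => constDigits t.1.1 t.1.2.1 t.2.1) :=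
    constDigitsC.comp ((CodeFP.fst _ _).fst'.pair ((CodeFP.fst _ _).snd'.fst'.pair (CodeFP.snd _ _).fst'))
  have hc : CodeFP (pairE hkE (pairE natE (pairE natE natE))) (rawE natE) (fun t => constDigits t.1.1 t.1.2.2 t.2.2.1) :=
    constDigitsC.comp ((CodeFP.fst _ _).fst'.pair ((CodeFP.fst _ _).snd'.snd'.pair (CodeFP.snd _ _).snd'.fst'))
  exact ((rawAppend natE).comp (hr.pair ((rawAppend natE).comp (hc.pair ((rawSingleton natE).comp (CodeFP.snd _ _).snd'.snd'))))).congr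
    fun t => rfl

/-- Mapping over a product list, row by row. [folklore] -/
theorem map_product_eq {α β γ : Type*} (l₁ : List α) (l₂ : List β) (g : α × β → γ) :
    (l₁.product l₂).map g = (l₁.map fun a => l₂.map fun b => g (a, b)).flatten := by
  induction l₁ with
  | nil => rfl
  | cons a l ih =>
    rw [List.map_cons, List.flatten_cons, ← ih]
    simp [List.product, List.flatMap_cons, List.map_map, Function.comp_def]

/-- The input of the honest oracle programme: `(((p, 1ʰ), (1^{kt}, 1^{kJ})), ((x, u), (1^{Tn}, (1^{Sn}, w))))`. [folklore] -/
abbrev yhInE : ((ℕ × ℕ) × (ℕ × ℕ)) × ((List Bool × List Bool) × (ℕ × (ℕ × List ℕ))) → List Bool :=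
  pairE (pairE qhE (pairE unE unE)) (pairE (pairE strE strE) (pairE unE (pairE unE (rawE natE))))

/-- **The honest oracle value is polynomial time in the unary step count**:
`(((p, 1ʰ), (1^{kt}, 1^{kJ})), ((x, u), (1^{Tn}, (1^{Sn}, w)))) ↦ YhN M p h kt kJ x u Tn Sn w`.
[cite: BFLS1991, §4] [cite: BabaiFortnowLund1991, §4] -/
theorem YhNC : CodeFP yhInE natE
    (fun t => YhN M t.1.1.1 t.1.1.2 t.1.2.1 t.1.2.2 t.2.1.1 t.2.1.2 t.2.2.1 t.2.2.2.1 t.2.2.2.2) := by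
  -- context `t`, item `(t', J)`; the step counts are made unary against the budgets `1^{Tn}`, `1^{Sn}`
  have hT : CodeFP (pairE yhInE (pairE natE natE)) unE (fun s => min s.2.1 s.1.2.2.1) :=
    unOfNatMin.comp ((CodeFP.fst _ _).snd'.snd'.fst'.pair (CodeFP.snd _ _).fst')
  have hJ : CodeFP (pairE yhInE (pairE natE natE)) unE (fun s => min s.2.2 s.1.2.2.2.1) :=
    unOfNatMin.comp ((CodeFP.fst _ _).snd'.snd'.snd'.fst'.pair (CodeFP.snd _ _).snd')
  have hcode : CodeFP (pairE yhInE (pairE natE natE)) natE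
      (fun s => cellCode M s.1.2.1.1 s.1.2.1.2 (min s.2.1 s.1.2.2.1) (min s.2.2 s.1.2.2.2.1)) :=
    (cellCodeC M).comp ((CodeFP.fst _ _).snd'.fst'.pair (hT.pair hJ))
  have hpt : CodeFP (pairE yhInE (pairE natE natE)) (rawE natE)
      (fun s => cellPtN s.1.1.1.2 s.1.1.2.1 s.1.1.2.2 s.2.1 s.2.2 (cellCode M s.1.2.1.1 s.1.2.1.2 (min s.2.1 s.1.2.2.1) (min s.2.2 s.1.2.2.2.1))) :=
    cellPtNC.comp (((CodeFP.fst _ _).fst'.fst'.snd'.pair (CodeFP.fst _ _).fst'.snd').pair ((CodeFP.snd _ _).fst'.pair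
      ((CodeFP.snd _ _).snd'.pair hcode)))
  have hI : CodeFP (pairE yhInE (pairE natE natE)) natE
      (fun s => ldeTermN s.1.1.1.1 s.1.1.1.2 (cellPtN s.1.1.1.2 s.1.1.2.1 s.1.1.2.2 s.2.1 s.2.2
        (cellCode M s.1.2.1.1 s.1.2.1.2 (min s.2.1 s.1.2.2.1) (min s.2.2 s.1.2.2.2.1))) s.1.2.2.2.2) :=
    ldeTermNC.comp ((CodeFP.fst _ _).fst'.fst'.pair (hpt.pair (CodeFP.fst _ _).snd'.snd'.snd'.snd'))
  -- the list of blocks `(t', J)`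
  have hL : CodeFP yhInE (rawE (pairE natE natE)) (fun t => (List.range t.2.2.1).product (List.range t.2.2.2.1)) :=
    (rawProduct natE natE).comp ((urange.comp (CodeFP.snd _ _).snd'.fst').pair (urange.comp (CodeFP.snd _ _).snd'.snd'.fst'))
  refine ((modSum (CodeFP.fst _ _).fst'.fst' ((CodeFP.map hI).comp ((CodeFP.id _).pair hL)))).congr fun t => ?_
  dsimp only [Function.comp_apply, id_eq]
  unfold YhN
  congr 1
  rw [map_product_eq]
  congr 1
  refine List.map_congr_left fun t' ht' => ?_
  refine List.map_congr_left fun J hJ => ?_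
  dsimp only
  rw [min_eq_left (List.mem_range.1 ht').le, min_eq_left (List.mem_range.1 hJ).le]

end FP

end TabEval

end Literature.Computability.Complexity

end
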